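import Mathlib
import HarnessLib
import Summits.Parity.BatemanHorn.Theorems.IsogenyRedeiSplitBlockJacobiCornerMbbSupport
import Summits.Parity.BatemanHorn.Theorems.IsogenyRedeiSplitBlockJacobiCornerMbbVaughan

/-!
# Support lemmas for `stub_mbb_of_boxInputs` (line `Sketch`, crux `SplitBlockJacobiCorner`,
# stmt-Parity-15002): expansion of the three Vaughan pieces of `B(Λ ⊗ Λ)` into box form

For the kernel `K_h(Q,Q') = (Q|Q')·S(h, QQ')` over `Q ∈ (P,t]`, `Q' ∈ (P',t']`, both `≡ 1 (mod 4)`: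

* `typeII_left_expand` — `Σ_Q Λ_II(Q) F(Q)` as the cut double sum
  `Σ_{b,r} [P < br ≤ t] a(b) c(r) G(br)` with `a = [b ≡ 1] μ_{>U}`, `c = [r ≡ 1] λ_U` and
  `G(n) = Σ_{Q'} Λ(Q') (n|Q') S(h, nQ')` (K2′ orientation);
* `typeII_right_expand` — the same for the second variable, the kernel re-oriented by reciprocity
  (`G'(n) = Σ_Q Λ_I(Q) (n|Q) S(h, nQ)`);
* `typeI_typeI_expand` — `Σ_{Q,Q'} Λ_I(Q) Λ_I(Q') K_h(Q,Q')` as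
  `Σ_{d,d' ≡ 1 (4)} Σ_{n ∈ (P/d, t/d]} Σ_{q ∈ (P'/d', t'/d']} [n ≡ q ≡ 1] K_h(dn, d'q) · w(d,n) w(d',q)`.

The congruence filters move by the support lemmas of `…CornerMbbSupport`.
-/

noncomputable section

open Finset ArithmeticFunction
open scoped ArithmeticFunction.Moebius

namespace Summit.Parity.BatemanHorn.Cruxes.SplitBlockJacobiCorner.Sketch.MbbOfBoxInputs

open Summit.Parity.BatemanHorn.Cruxes.SplitBlockJacobi.CofactorRootDiscrepancy

/-! ### Filter moves through a sum, and the range conversion -/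

/-- Sum form of the left filter move: `[ab ≡ 1] X·Σᵢ cᵢ S(h, ab·qᵢ) = [a ≡ 1][b ≡ 1] X·Σᵢ cᵢ S(h, ab·qᵢ)`.
[folklore] -/
theorem ite_mul_mod_four_left_sum {ι : Type*} (s : Finset ι) (a b : ℕ) (q : ι → ℕ) (c : ι → ℂ)
    (X : ℂ) (h : ℤ) :
    (if (a * b) % 4 = 1 then X * ∑ i ∈ s, c i * rootWeylSum h (a * b * q i) else 0) =
      if a % 4 = 1 ∧ b % 4 = 1 then X * ∑ i ∈ s, c i * rootWeylSum h (a * b * q i) else 0 := by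
  by_cases ha : a % 4 = 1
  · have hab : (a * b) % 4 = b % 4 := by rw [Nat.mul_mod, ha, one_mul, Nat.mod_mod]
    rw [hab]
    exact if_congr ⟨fun hb => ⟨ha, hb⟩, fun h => h.2⟩ rfl rfl
  · rw [if_neg (show ¬(a % 4 = 1 ∧ b % 4 = 1) from fun h => ha h.1)]
    split_ifs with hab
    · have hodd' : Odd (a * b) := Nat.odd_iff.mpr (by omega)
      have hodd : Odd a := (Nat.odd_mul.mp hodd').1
      rw [Finset.sum_eq_zero (fun i _ => ?_), mul_zero]
      rw [rootWeylSum_eq_zero_of_odd_dvd hodd ha ((dvd_mul_right a b).trans (dvd_mul_right _ _)) h,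
        mul_zero]
    · rfl

/-- Sum form of the right filter move: `[ab ≡ 1] X·Σᵢ cᵢ S(h, nᵢ·(ab)) = [a ≡ 1][b ≡ 1] (…)`.
[folklore] -/
theorem ite_mul_mod_four_right_sum {ι : Type*} (s : Finset ι) (a b : ℕ) (n : ι → ℕ) (c : ι → ℂ)
    (X : ℂ) (h : ℤ) :
    (if (a * b) % 4 = 1 then X * ∑ i ∈ s, c i * rootWeylSum h (n i * (a * b)) else 0) =
      if a % 4 = 1 ∧ b % 4 = 1 then X * ∑ i ∈ s, c i * rootWeylSum h (n i * (a * b)) else 0 := by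
  by_cases ha : a % 4 = 1
  · have hab : (a * b) % 4 = b % 4 := by rw [Nat.mul_mod, ha, one_mul, Nat.mod_mod]
    rw [hab]
    exact if_congr ⟨fun hb => ⟨ha, hb⟩, fun h => h.2⟩ rfl rfl
  · rw [if_neg (show ¬(a % 4 = 1 ∧ b % 4 = 1) from fun h => ha h.1)]
    split_ifs with hab
    · have hodd' : Odd (a * b) := Nat.odd_iff.mpr (by omega)
      have hodd : Odd a := (Nat.odd_mul.mp hodd').1
      rw [Finset.sum_eq_zero (fun i _ => ?_), mul_zero]
      rw [rootWeylSum_eq_zero_of_odd_dvd hodd ha ((dvd_mul_right a b).trans (dvd_mul_left _ _)) h,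
        mul_zero]
    · rfl

/-- Range conversion: for `d ≥ 1`, `Σ_{n ≤ T} [P < dn ≤ t] φ(n) = Σ_{n ∈ (P/d, t/d]} φ(n)` (`t ≤ T`).
[folklore] -/
theorem sum_ite_cut_eq_sum_Ioc_div {β : Type*} [AddCommMonoid β] (φ : ℕ → β) {d P t T : ℕ}
    (hd : 1 ≤ d) (htT : t ≤ T) :
    ∑ n ∈ Ioc 0 T, (if P < d * n ∧ d * n ≤ t then φ n else 0) = ∑ n ∈ Ioc (P / d) (t / d), φ n := by
  rw [← Finset.sum_filter]
  congr 1
  ext n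
  simp only [Finset.mem_filter, Finset.mem_Ioc]
  rw [Nat.div_lt_iff_lt_mul (by omega), Nat.le_div_iff_mul_le (by omega)]
  constructor
  · rintro ⟨-, h1, h2⟩
    exact ⟨by rw [mul_comm]; exact h1, by rw [mul_comm]; exact h2⟩
  · rintro ⟨h1, h2⟩
    refine ⟨⟨?_, ?_⟩, by rw [mul_comm]; exact h1, by rw [mul_comm]; exact h2⟩
    · rcases Nat.eq_zero_or_pos n with rfl | hn
      · simp at h1
      · exact hn
    · calc n ≤ n * d := Nat.le_mul_of_pos_right n hd
        _ ≤ t := h2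
        _ ≤ T := htT

/-! ### The Type II pieces -/

/-- **Expansion of `B(Λ_II ⊗ g)`** (Type II on the first variable): for any coefficient `g` on the
second variable,
`Σ_{Q ∈ (P,t], Q≡1} Λ_II(Q) Σ_{Q' ∈ S'} g(Q') (Q|Q') S(h,QQ') = Σ_{b,r ≤ t} [P < br ≤ t] a(b) c(r) G(br)`
with `a(b) = [b≡1] μ_{>U}(b)`, `c(r) = [r≡1] λ_U(r)`, `G(n) = Σ_{Q' ∈ S'} g(Q') (n|Q') S(h, nQ')`.
[folklore] -/
theorem typeII_left_expand (U P t : ℕ) (h : ℤ) (S' : Finset ℕ) (g : ℕ → ℂ) :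
    ∑ Q ∈ (Ioc P t).filter (fun Q : ℕ => Q % 4 = 1), (((∑ y ∈ Nat.divisorsAntidiagonal Q, (if U < y.1 then (((μ y.1 : ℤ)) : ℝ) else 0) * (∑ c ∈ Nat.divisors y.2, if U < c then Λ c else 0)) : ℝ) : ℂ) *
        ∑ Q' ∈ S', g Q' * ((jacobiSym (Q : ℤ) Q' : ℂ) * rootWeylSum h (Q * Q')) =
      ∑ b ∈ Ioc 0 t, ∑ r ∈ Ioc 0 t,
        if P < b * r ∧ b * r ≤ t then
          (if b % 4 = 1 then (((if U < b then (((μ b : ℤ)) : ℝ) else 0) : ℝ) : ℂ) else 0) *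
            (if r % 4 = 1 then (((∑ c ∈ Nat.divisors r, if U < c then Λ c else 0) : ℝ) : ℂ) else 0) *
            ∑ Q' ∈ S', g Q' * ((jacobiSym ((b * r : ℕ) : ℤ) Q' : ℂ) * rootWeylSum h (b * r * Q'))
        else 0 := by
  set X : ℕ → ℂ := fun a => (((if U < a then (((μ a : ℤ)) : ℝ) else 0) : ℝ) : ℂ) with hX
  set Y : ℕ → ℂ := fun b => (((∑ c ∈ Nat.divisors b, if U < c then Λ c else 0) : ℝ) : ℂ) with hY
  set ψ : ℕ → ℕ → ℂ := fun a b => X a * Y b with hψ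
  have hcast : ∀ Q : ℕ, (((∑ y ∈ Nat.divisorsAntidiagonal Q, (if U < y.1 then (((μ y.1 : ℤ)) : ℝ) else 0) * (∑ c ∈ Nat.divisors y.2, if U < c then Λ c else 0)) : ℝ) : ℂ) = ∑ y ∈ Nat.divisorsAntidiagonal Q, ψ y.1 y.2 := by
    intro Q
    simp only [hψ, hX, hY]
    push_cast
    rfl
  simp_rw [hcast]
  rw [sum_antidiagonal_mul_eq]
  show _ = ∑ b ∈ Ioc 0 t, ∑ r ∈ Ioc 0 t, if P < b * r ∧ b * r ≤ t then
    (if b % 4 = 1 then X b else 0) * (if r % 4 = 1 then Y r else 0) *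
      ∑ Q' ∈ S', g Q' * ((jacobiSym ((b * r : ℕ) : ℤ) Q' : ℂ) * rootWeylSum h (b * r * Q')) else 0
  refine Finset.sum_congr rfl fun b _ => Finset.sum_congr rfl fun r _ => ?_
  by_cases hA : P < b * r ∧ b * r ≤ t
  · simp only [hA, true_and, if_true]
    by_cases hbr : b % 4 = 1 ∧ r % 4 = 1
    · have hbr1 : (b * r) % 4 = 1 := by rw [Nat.mul_mod, hbr.1, hbr.2]
      rw [if_pos hbr1, if_pos hbr.1, if_pos hbr.2]
    · have hR : (if b % 4 = 1 then X b else 0) * (if r % 4 = 1 then Y r else 0) = 0 := by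
        rcases not_and_or.mp hbr with h1 | h1 <;> simp [h1]
      rw [hR, zero_mul]
      by_cases hbr1 : (b * r) % 4 = 1
      · -- `br ≡ 1` but not both `≡ 1`: an odd divisor `≢ 1 (4)` kills every `S(h, br·Q')`
        rw [if_pos hbr1]
        have hodd : Odd (b * r) := Nat.odd_iff.mpr (by omega)
        obtain ⟨hb, hr⟩ := Nat.odd_mul.mp hodd
        rw [Finset.sum_eq_zero (fun Q' _ => ?_), mul_zero]
        rcases not_and_or.mp hbr with h1 | h1
        · rw [rootWeylSum_eq_zero_of_odd_dvd hb h1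
            ((dvd_mul_right b r).trans (dvd_mul_right _ _)) h, mul_zero, mul_zero]
        · rw [rootWeylSum_eq_zero_of_odd_dvd hr h1
            ((dvd_mul_left r b).trans (dvd_mul_right _ _)) h, mul_zero, mul_zero]
      · rw [if_neg hbr1]
  · simp only [hA, false_and, if_false]

/-- **Expansion of `B(f ⊗ Λ_II)`** (Type II on the second variable), with the kernel RE-ORIENTED by
quadratic reciprocity (sign `+1` on the support, `kernel_swap`): for `S ⊆ {Q ≡ 1 (4)}`,
`Σ_{Q' ∈ (P',t'], Q'≡1} Λ_II(Q') Σ_{Q ∈ S} f(Q) (Q|Q') S(h,QQ') = Σ_{b,r ≤ t'} [P' < br ≤ t'] a(b) c(r) G'(br)`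
with `G'(n) = Σ_{Q ∈ S} f(Q) (n|Q) S(h, nQ)`. [folklore] -/
theorem typeII_right_expand (U P' t' : ℕ) (h : ℤ) (S : Finset ℕ) (hS : ∀ Q ∈ S, Q % 4 = 1)
    (f : ℕ → ℂ) :
    ∑ Q' ∈ (Ioc P' t').filter (fun Q' : ℕ => Q' % 4 = 1), (((∑ y ∈ Nat.divisorsAntidiagonal Q', (if U < y.1 then (((μ y.1 : ℤ)) : ℝ) else 0) * (∑ c ∈ Nat.divisors y.2, if U < c then Λ c else 0)) : ℝ) : ℂ) *
        ∑ Q ∈ S, f Q * ((jacobiSym (Q : ℤ) Q' : ℂ) * rootWeylSum h (Q * Q')) =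
      ∑ b ∈ Ioc 0 t', ∑ r ∈ Ioc 0 t',
        if P' < b * r ∧ b * r ≤ t' then
          (if b % 4 = 1 then (((if U < b then (((μ b : ℤ)) : ℝ) else 0) : ℝ) : ℂ) else 0) *
            (if r % 4 = 1 then (((∑ c ∈ Nat.divisors r, if U < c then Λ c else 0) : ℝ) : ℂ) else 0) *
            ∑ Q ∈ S, f Q * ((jacobiSym ((b * r : ℕ) : ℤ) Q : ℂ) * rootWeylSum h (b * r * Q))
        else 0 := by
  set X : ℕ → ℂ := fun a => (((if U < a then (((μ a : ℤ)) : ℝ) else 0) : ℝ) : ℂ) with hX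
  set Y : ℕ → ℂ := fun b => (((∑ c ∈ Nat.divisors b, if U < c then Λ c else 0) : ℝ) : ℂ) with hY
  set ψ : ℕ → ℕ → ℂ := fun a b => X a * Y b with hψ
  have hcast : ∀ Q : ℕ, (((∑ y ∈ Nat.divisorsAntidiagonal Q, (if U < y.1 then (((μ y.1 : ℤ)) : ℝ) else 0) * (∑ c ∈ Nat.divisors y.2, if U < c then Λ c else 0)) : ℝ) : ℂ) = ∑ y ∈ Nat.divisorsAntidiagonal Q, ψ y.1 y.2 := by
    intro Q
    simp only [hψ, hX, hY]
    push_cast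
    rfl
  simp_rw [hcast]
  rw [sum_antidiagonal_mul_eq]
  show _ = ∑ b ∈ Ioc 0 t', ∑ r ∈ Ioc 0 t', if P' < b * r ∧ b * r ≤ t' then
    (if b % 4 = 1 then X b else 0) * (if r % 4 = 1 then Y r else 0) *
      ∑ Q ∈ S, f Q * ((jacobiSym ((b * r : ℕ) : ℤ) Q : ℂ) * rootWeylSum h (b * r * Q)) else 0
  refine Finset.sum_congr rfl fun b _ => Finset.sum_congr rfl fun r _ => ?_
  by_cases hA : P' < b * r ∧ b * r ≤ t'
  · simp only [hA, true_and, if_true]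
    by_cases hbr : b % 4 = 1 ∧ r % 4 = 1
    · have hbr1 : (b * r) % 4 = 1 := by rw [Nat.mul_mod, hbr.1, hbr.2]
      rw [if_pos hbr1, if_pos hbr.1, if_pos hbr.2]
      congr 1
      refine Finset.sum_congr rfl fun Q hQ => ?_
      rw [kernel_swap (hS Q hQ) hbr1 h, Nat.cast_mul]
    · have hR : (if b % 4 = 1 then X b else 0) * (if r % 4 = 1 then Y r else 0) = 0 := by
        rcases not_and_or.mp hbr with h1 | h1 <;> simp [h1]
      rw [hR, zero_mul]
      by_cases hbr1 : (b * r) % 4 = 1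
      · -- `br ≡ 1` but not both `≡ 1`: an odd divisor `≢ 1 (4)` kills every `S(h, Q·br)`
        rw [if_pos hbr1]
        have hodd : Odd (b * r) := Nat.odd_iff.mpr (by omega)
        obtain ⟨hb, hr⟩ := Nat.odd_mul.mp hodd
        rw [Finset.sum_eq_zero (fun Q _ => ?_), mul_zero]
        rcases not_and_or.mp hbr with h1 | h1
        · rw [rootWeylSum_eq_zero_of_odd_dvd hb h1
            ((dvd_mul_right b r).trans (dvd_mul_left _ _)) h, mul_zero, mul_zero]
        · rw [rootWeylSum_eq_zero_of_odd_dvd hr h1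
            ((dvd_mul_left r b).trans (dvd_mul_left _ _)) h, mul_zero, mul_zero]
      · rw [if_neg hbr1]
  · simp only [hA, false_and, if_false]

/-! ### The Type I × Type I piece -/

/-- An `if` with alternative `0` commutes with a finite sum. [folklore] -/
theorem ite_sum_zero {ι : Type*} (s : Finset ι) (c : Prop) [Decidable c] (f : ι → ℂ) :
    (if c then ∑ i ∈ s, f i else 0) = ∑ i ∈ s, (if c then f i else 0) := by
  split_ifs <;> simp

/-- Both congruence filters at once, pointwise: `[dn ≡ 1][d'q ≡ 1] X·S(h, dn·d'q) =
[d ≡ d' ≡ 1][n ≡ q ≡ 1] X·S(h, dn·d'q)`. [folklore] -/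
theorem filter_pointwise (d n d' q : ℕ) (h : ℤ) (X : ℂ) :
    (if (d * n) % 4 = 1 ∧ (d' * q) % 4 = 1 then X * rootWeylSum h (d * n * (d' * q)) else 0) =
      if (d % 4 = 1 ∧ d' % 4 = 1) ∧ (n % 4 = 1 ∧ q % 4 = 1) then
        X * rootWeylSum h (d * n * (d' * q)) else 0 := by
  by_cases hS : rootWeylSum h (d * n * (d' * q)) = 0
  · simp [hS]
  · refine if_congr ?_ rfl rfl
    rw [mul_mod_four_eq_one_iff_of_rootWeylSum_ne_zero hS (dvd_mul_right _ _),
      mul_mod_four_eq_one_iff_of_rootWeylSum_ne_zero hS (dvd_mul_left _ _)]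
    tauto

/-- **Expansion of `B(Λ_I ⊗ Λ_I)`**:
`Σ_{Q ∈ (P,t],Q≡1} Σ_{Q' ∈ (P',t'],Q'≡1} Λ_I(Q) Λ_I(Q') (Q|Q') S(h, QQ')
 = Σ_{d ≤ t} Σ_{d' ≤ t'} [d ≡ d' ≡ 1] Σ_{n ∈ (P/d,t/d]} Σ_{q ∈ (P'/d',t'/d']} ([n ≡ q ≡ 1] (dn|d'q) S(h, dn·d'q)) · (w(d,n) w(d',q))`.
[folklore] -/
theorem typeI_typeI_expand (U P t P' t' : ℕ) (h : ℤ) :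
    ∑ Q ∈ (Ioc P t).filter (fun Q : ℕ => Q % 4 = 1),
      ∑ Q' ∈ (Ioc P' t').filter (fun Q' : ℕ => Q' % 4 = 1),
        (((∑ d ∈ Nat.divisors Q, ((if d ≤ U then (((μ d : ℤ)) : ℝ) else 0) * Real.log (((Q / d : ℕ)) : ℝ) - (∑ y ∈ Nat.divisorsAntidiagonal d, (if y.1 ≤ U then (((μ y.1 : ℤ)) : ℝ) else 0) * (if y.2 ≤ U then Λ y.2 else 0)))) : ℝ) : ℂ) * (((∑ d ∈ Nat.divisors Q', ((if d ≤ U then (((μ d : ℤ)) : ℝ) else 0) * Real.log (((Q' / d : ℕ)) : ℝ) - (∑ y ∈ Nat.divisorsAntidiagonal d, (if y.1 ≤ U then (((μ y.1 : ℤ)) : ℝ) else 0) * (if y.2 ≤ U then Λ y.2 else 0)))) : ℝ) : ℂ) * ((jacobiSym (Q : ℤ) Q' : ℂ) * rootWeylSum h (Q * Q')) =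
      ∑ d ∈ Ioc 0 t, ∑ d' ∈ Ioc 0 t',
        if d % 4 = 1 ∧ d' % 4 = 1 then
          ∑ n ∈ Ioc (P / d) (t / d), ∑ q ∈ Ioc (P' / d') (t' / d'),
            (if n % 4 = 1 ∧ q % 4 = 1 then
                (jacobiSym ((d * n : ℕ) : ℤ) (d' * q) : ℂ) * rootWeylSum h (d * n * (d' * q)) else 0) *
              (((((if d ≤ U then (((μ d : ℤ)) : ℝ) else 0) * Real.log ((n : ℕ) : ℝ) - (∑ y ∈ Nat.divisorsAntidiagonal d, (if y.1 ≤ U then (((μ y.1 : ℤ)) : ℝ) else 0) * (if y.2 ≤ U then Λ y.2 else 0))) : ℝ) : ℂ) * ((((if d' ≤ U then (((μ d' : ℤ)) : ℝ) else 0) * Real.log ((q : ℕ) : ℝ) - (∑ y ∈ Nat.divisorsAntidiagonal d', (if y.1 ≤ U then (((μ y.1 : ℤ)) : ℝ) else 0) * (if y.2 ≤ U then Λ y.2 else 0))) : ℝ) : ℂ))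
        else 0 := by
  -- Step 0: `Λ_I` as an antidiagonal sum of the weight `ψ(d,n) = w(d,n)`, cast to `ℂ`
  set ψ : ℕ → ℕ → ℂ := fun a b => ((((if a ≤ U then (((μ a : ℤ)) : ℝ) else 0) * Real.log ((b : ℕ) : ℝ) - (∑ y ∈ Nat.divisorsAntidiagonal a, (if y.1 ≤ U then (((μ y.1 : ℤ)) : ℝ) else 0) * (if y.2 ≤ U then Λ y.2 else 0))) : ℝ) : ℂ) with hψ
  have hcast : ∀ Q : ℕ, (((∑ d ∈ Nat.divisors Q, ((if d ≤ U then (((μ d : ℤ)) : ℝ) else 0) * Real.log (((Q / d : ℕ)) : ℝ) - (∑ y ∈ Nat.divisorsAntidiagonal d, (if y.1 ≤ U then (((μ y.1 : ℤ)) : ℝ) else 0) * (if y.2 ≤ U then Λ y.2 else 0)))) : ℝ) : ℂ) = ∑ y ∈ Nat.divisorsAntidiagonal Q, ψ y.1 y.2 := by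
    intro Q
    rw [Nat.sum_divisorsAntidiagonal (fun a b => ψ a b)]
    simp only [hψ]
    push_cast
    rfl
  -- the kernel, abbreviated
  set K : ℕ → ℕ → ℂ := fun Q Q' => (jacobiSym (Q : ℤ) Q' : ℂ) * rootWeylSum h (Q * Q') with hK
  have hKdef : ∀ Q Q' : ℕ, (jacobiSym (Q : ℤ) Q' : ℂ) * rootWeylSum h (Q * Q') = K Q Q' :=
    fun _ _ => rfl
  simp_rw [hKdef]
  -- Step 1: expand the first variable
  have h1 : ∀ Q ∈ (Ioc P t).filter (fun Q : ℕ => Q % 4 = 1),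
      ∑ Q' ∈ (Ioc P' t').filter (fun Q' : ℕ => Q' % 4 = 1),
        (((∑ d ∈ Nat.divisors Q, ((if d ≤ U then (((μ d : ℤ)) : ℝ) else 0) * Real.log (((Q / d : ℕ)) : ℝ) - (∑ y ∈ Nat.divisorsAntidiagonal d, (if y.1 ≤ U then (((μ y.1 : ℤ)) : ℝ) else 0) * (if y.2 ≤ U then Λ y.2 else 0)))) : ℝ) : ℂ) * (((∑ d ∈ Nat.divisors Q', ((if d ≤ U then (((μ d : ℤ)) : ℝ) else 0) * Real.log (((Q' / d : ℕ)) : ℝ) - (∑ y ∈ Nat.divisorsAntidiagonal d, (if y.1 ≤ U then (((μ y.1 : ℤ)) : ℝ) else 0) * (if y.2 ≤ U then Λ y.2 else 0)))) : ℝ) : ℂ) * K Q Q' =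
      (∑ y ∈ Nat.divisorsAntidiagonal Q, ψ y.1 y.2) *
        ∑ Q' ∈ (Ioc P' t').filter (fun Q' : ℕ => Q' % 4 = 1), (((∑ d ∈ Nat.divisors Q', ((if d ≤ U then (((μ d : ℤ)) : ℝ) else 0) * Real.log (((Q' / d : ℕ)) : ℝ) - (∑ y ∈ Nat.divisorsAntidiagonal d, (if y.1 ≤ U then (((μ y.1 : ℤ)) : ℝ) else 0) * (if y.2 ≤ U then Λ y.2 else 0)))) : ℝ) : ℂ) * K Q Q' := by
    intro Q _
    rw [← hcast Q, Finset.mul_sum]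
    refine Finset.sum_congr rfl fun Q' _ => ?_
    ring
  rw [Finset.sum_congr rfl h1, sum_antidiagonal_mul_eq]
  -- Step 2: expand the second variable inside, for each `(d, n)`
  have h2 : ∀ d n : ℕ,
      ∑ Q' ∈ (Ioc P' t').filter (fun Q' : ℕ => Q' % 4 = 1), (((∑ d ∈ Nat.divisors Q', ((if d ≤ U then (((μ d : ℤ)) : ℝ) else 0) * Real.log (((Q' / d : ℕ)) : ℝ) - (∑ y ∈ Nat.divisorsAntidiagonal d, (if y.1 ≤ U then (((μ y.1 : ℤ)) : ℝ) else 0) * (if y.2 ≤ U then Λ y.2 else 0)))) : ℝ) : ℂ) * K (d * n) Q' =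
        ∑ d' ∈ Ioc 0 t', ∑ q ∈ Ioc 0 t',
          if (P' < d' * q ∧ d' * q ≤ t') ∧ (d' * q) % 4 = 1 then ψ d' q * K (d * n) (d' * q)
          else 0 := by
    intro d n
    simp_rw [hcast]
    rw [sum_antidiagonal_mul_eq]
  simp_rw [h2]
  -- Step 3: push the outer weight and filter inside, and move both filters pointwise
  have h3 : ∀ d n d' q : ℕ,
      (if (P < d * n ∧ d * n ≤ t) ∧ (d * n) % 4 = 1 then
          ψ d n * (if (P' < d' * q ∧ d' * q ≤ t') ∧ (d' * q) % 4 = 1 then ψ d' q * K (d * n) (d' * q)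
            else 0)
        else 0) =
      if d % 4 = 1 ∧ d' % 4 = 1 then
        (if P < d * n ∧ d * n ≤ t then
          (if P' < d' * q ∧ d' * q ≤ t' then
            (if n % 4 = 1 ∧ q % 4 = 1 then K (d * n) (d' * q) else 0) * (ψ d n * ψ d' q)
          else 0)
        else 0)
      else 0 := by
    intro d n d' q
    have key := filter_pointwise d n d' q h
      (ψ d n * ψ d' q * (jacobiSym ((d * n : ℕ) : ℤ) (d' * q) : ℂ))
    by_cases hA : P < d * n ∧ d * n ≤ t
    · by_cases hB : P' < d' * q ∧ d' * q ≤ t'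
      · simp only [hA, hB, true_and, if_true]
        rw [mul_ite, mul_zero, ← ite_and]
        rw [show ψ d n * (ψ d' q * K (d * n) (d' * q)) =
            ψ d n * ψ d' q * (jacobiSym ((d * n : ℕ) : ℤ) (d' * q) : ℂ) *
              rootWeylSum h (d * n * (d' * q)) by simp only [hK]; push_cast; ring, key, ite_and]
        by_cases hD : d % 4 = 1 ∧ d' % 4 = 1
        · simp only [hD, if_true, true_and]
          simp only [hK]
          push_cast
          split_ifs <;> ring
        · simp only [hD, if_false]
      · simp only [hA, hB, true_and, false_and, if_false, mul_zero, ite_self]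
    · simp only [hA, false_and, if_false, ite_self]
  have h3' : ∀ d n : ℕ,
      (if (P < d * n ∧ d * n ≤ t) ∧ (d * n) % 4 = 1 then
          ψ d n * ∑ d' ∈ Ioc 0 t', ∑ q ∈ Ioc 0 t',
            (if (P' < d' * q ∧ d' * q ≤ t') ∧ (d' * q) % 4 = 1 then ψ d' q * K (d * n) (d' * q)
            else 0)
        else 0) =
      ∑ d' ∈ Ioc 0 t', ∑ q ∈ Ioc 0 t',
        if d % 4 = 1 ∧ d' % 4 = 1 then
          (if P < d * n ∧ d * n ≤ t then
            (if P' < d' * q ∧ d' * q ≤ t' then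
              (if n % 4 = 1 ∧ q % 4 = 1 then K (d * n) (d' * q) else 0) * (ψ d n * ψ d' q)
            else 0)
          else 0)
        else 0 := by
    intro d n
    rw [Finset.mul_sum, ite_sum_zero]
    refine Finset.sum_congr rfl fun d' _ => ?_
    rw [Finset.mul_sum, ite_sum_zero]
    refine Finset.sum_congr rfl fun q _ => ?_
    exact h3 d n d' q
  simp_rw [h3']
  -- Step 4: reorder to `Σ_d Σ_{d'} Σ_n Σ_q`, pull `[d ≡ d' ≡ 1]` out, convert the ranges
  refine Finset.sum_congr rfl fun d hd => ?_
  rw [Finset.sum_comm]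
  refine Finset.sum_congr rfl fun d' hd' => ?_
  have hd1 : 1 ≤ d := (Finset.mem_Ioc.mp hd).1
  have hd'1 : 1 ≤ d' := (Finset.mem_Ioc.mp hd').1
  by_cases hD : d % 4 = 1 ∧ d' % 4 = 1
  · simp only [hD, if_true, true_and]
    rw [← sum_ite_cut_eq_sum_Ioc_div _ hd1 le_rfl]
    refine Finset.sum_congr rfl fun n _ => ?_
    rw [← sum_ite_cut_eq_sum_Ioc_div _ hd'1 le_rfl, ite_sum_zero]
  · simp only [hD, if_false, Finset.sum_const_zero]

end Summit.Parity.BatemanHorn.Cruxes.SplitBlockJacobiCorner.Sketch.MbbOfBoxInputs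

namespace Summit.Parity.BatemanHorn.Cruxes.SplitBlockJacobiCorner.Sketch

/-- **Registered stub form** (the range conversion of the Type I box): restated in `∀`-form in the crux-line namespace under
the name registered on stmt-Parity-15002. [folklore] -/
theorem mbbExpand_range :
    ∀ (φ : ℕ → ℂ) (d P t T : ℕ), 1 ≤ d → t ≤ T → ∑ n ∈ Finset.Ioc 0 T, (if P < d * n ∧ d * n ≤ t then φ n else 0) = ∑ n ∈ Finset.Ioc (P / d) (t / d), φ n :=
  fun φ _ _ _ _ hd htT => MbbOfBoxInputs.sum_ite_cut_eq_sum_Ioc_div φ hd htT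

end Summit.Parity.BatemanHorn.Cruxes.SplitBlockJacobiCorner.Sketch

end
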